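import Mathlib
import HarnessLib
import Summits.QuantumFields.YangMills.Theorems.ConvexGribovBodyContinuumLegGivenGapStubUclOfCsclA
import Summits.QuantumFields.YangMills.Theorems.ConvexGribovBodyContinuumLegGivenGapStubUclOfCsclTilt

/-!
# `ContinuumLegGivenGap` (stmt-QuantumFields-15828), line `Sketch` (reshape 15): kinematics for `stub_uclOfCscl` — part B

Support file for the crux item stmt-QuantumFields-15828 (registered glue stub `stub_uclOfCscl`, reshape 15). Part B is
the TILT: for finite families of slab-ordered real product tensors with time- and `x^{i+1}`-bounded factors and a
determinant-one isometry `R` of `ℝ⁴` with `(Rx)⁰ = c x⁰ + s x^{i+1}`, `c ∈ (0,1]`, `(1−c)`, `|s|` small against the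
slab margins (the landed `stub_smallRotation`),
(the tilt kinematics `linActMulti_osAdjoint_conj`, `conjRot_apply_zero`, `isSlabOrdered_tilt` are in the companion file
`…StubUclOfCsclTilt`):
* `span_main` — for `P, Q` in the spans of the `x^{i+1}`-bounded slab-ordered real product tensors and a spatial
  direction `a` with `a^{i+1} ≠ 0`: `‖𝓓(ΘP* ⊗ T_{ta}Q) − 𝓓(ΘP*)𝓓(Q)‖ ≤ e^{−Δ(σ₀t)} M + η` eventually in `k`, every
  `t ≥ 0`, with `σ₀ > 0`, `M ≥ 0` independent of `t` ((CSCL) on the spans — landed `clustersCS_sum` — applied to the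
  tilted pair `(R'·P, T_w(R·Q))` at TIME separation `σ₀ t = (R(ta))⁰`, Cauchy–Schwarz norms made `t`-uniform by the
  translation half of E1, the tilt undone by asymptotic rotation invariance). [folklore]
-/

noncomputable section

namespace Summit.QuantumFields.YangMills.Theorems.ContinuumLegGivenGap

open scoped SchwartzMap ComplexConjugate
open Filter Topology MeasureTheory
open Literature.MathematicalPhysics.QuantumFieldTheory Literature.MathematicalPhysics.QuantumLattice
  Literature.MathematicalPhysics.AQFT Literature.Probability.LatticeModels
open Summit.QuantumFields.YangMills.Cruxes.ContinuumLimitOnTrajectory.TwoOrbitSynchronisation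
  (curvDistribution curvCLM curvCLM_apply curvDistribution_sub curvDistribution_zero curvDistribution_smul
   curvDistribution_add canon UUVB UVB ARP AsympTransl PolyVolumeGrowth PlaqIdx stub_transl)
open Summit.QuantumFields.YangMills.Cruxes.LatticeGapOnTrajectory.OrbitKantorovichFiniteSize.Transfer
  (tsupport_translateTest_subset)

/-! ## §1 The main term on the spans -/

section Main

variable {G : Type} [Group G] [TopologicalSpace G] [IsTopologicalGroup G] [CompactSpace G]
  [MeasurableSpace G] [BorelSpace G] (r : LatticeRep G) (sch : SpeciesScheme (YMSpecies G))

/-- A tendsto-zero sequence is eventually below any positive bound in norm. [folklore] -/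
theorem eventually_norm_le_of_tendsto_zero {u : ℕ → ℂ} (hu : Tendsto u atTop (𝓝 0)) {ε : ℝ} (hε : 0 < ε) :
    ∀ᶠ k in atTop, ‖u k‖ ≤ ε := by
  have := hu.norm
  rw [norm_zero] at this
  exact (this.eventually (ge_mem_nhds hε)).mono fun k hk => hk

omit [TopologicalSpace G] [IsTopologicalGroup G] [CompactSpace G] [MeasurableSpace G] [BorelSpace G] [Group G] in
/-- Elements of the span of the `x^{i+1}`-bounded slab-ordered real product tensors lie in the span of all slab-ordered
real product tensors (hence are time-ordered). [folklore] -/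
theorem mem_span_slabOrderedProducts_of_mem_span_bdd {n : ℕ} {i : Fin 3}
    {P : 𝓢((Fin n → EuclideanSpace ℝ (Fin 4)), ℂ)}
    (hP : P ∈ Submodule.span ℂ {P : 𝓢((Fin n → EuclideanSpace ℝ (Fin 4)), ℂ) |
        ∃ (p : Fin n → 𝓢(EuclideanSpace ℝ (Fin 4), ℝ)) (ρ : ℝ),
          IsTensorOf P (fun l => ofRealTest (p l)) ∧ IsSlabOrdered p ∧
            ∀ l, tsupport (p l : EuclideanSpace ℝ (Fin 4) → ℝ) ⊆ {x | |x i.succ| ≤ ρ}}) :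
    P ∈ Submodule.span ℂ (slabOrderedProducts 4 n) := by
  refine Submodule.span_mono (fun P' hP' => ?_) hP
  obtain ⟨p, -, hpT, hp, -⟩ := hP'
  exact hp.mem_slabOrderedProducts hpT

/-- **The main term on the spans.** For `P`, `Q` in the `ℂ`-spans of the `x^{i+1}`-bounded slab-ordered real product
tensors (arities `n, m ≥ 1`), a spatial direction `a` with `a^{i+1} ≠ 0` and `η > 0`, there are `σ₀ > 0` and `M ≥ 0`
such that for every `t ≥ 0`, EVENTUALLY in `k`,
`‖𝓓_{n+m}(ΘP* ⊗ T_{ta}Q) − 𝓓ₙ(ΘP*) 𝓓ₘ(Q)‖ ≤ e^{−Δ(σ₀ t)} M + η`.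
Tilt the `x^{i+1}`-axis into time by the small proper rotation `R` of the rotation statement `hB` (landed
`stub_smallRotation`) fitted to the time bound, the `x^{i+1}`-bound and the slab margins of the finitely many factor
data; `R·(ΘP* ⊗ T_{ta}Q) = Θ(R'·P)* ⊗ T_{σ₀t e₀}(T_w (R·Q))` with `R' = θRθ`, `σ₀ = s a^{i+1} > 0`, `w` spatial; the tilted
data are slab-ordered (`isSlabOrdered_tilt`), so (CSCL) on the spans (`clustersCS_sum`) applies at TIME separation
`σ₀t`; the Cauchy–Schwarz norm of the `Q`-side is made `t`-uniform by the translation half of E1, and `R`, `T_w` are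
removed from the three distributions by asymptotic rotation / translation invariance. [folklore] -/
theorem span_main
    (hB : ∀ (i : Fin 3) (σ ρ g : ℝ), σ ≠ 0 → 0 < ρ → 0 < g →
      ∃ (R : EuclideanSpace ℝ (Fin 4) ≃ₗᵢ[ℝ] EuclideanSpace ℝ (Fin 4)) (c s : ℝ),
        LinearMap.det (R.toLinearEquiv : EuclideanSpace ℝ (Fin 4) →ₗ[ℝ] EuclideanSpace ℝ (Fin 4)) = 1 ∧
        (∀ x : EuclideanSpace ℝ (Fin 4), R x 0 = c * x 0 + s * x i.succ) ∧
        (∀ x : EuclideanSpace ℝ (Fin 4), R.symm x 0 = c * x 0 - s * x i.succ) ∧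
        0 < σ * s ∧ 0 < c ∧ c ≤ 1 ∧ (1 - c) * ρ ≤ g ∧ |s| * ρ ≤ g)
    (hTr : AsympTransl r sch)
    (hROT : ∀ (p : ℕ) (F : 𝓢((Fin p → EuclideanSpace ℝ (Fin 4)), ℂ)), IsOffDiagonal F →
      ∀ R : EuclideanSpace ℝ (Fin 4) ≃ₗᵢ[ℝ] EuclideanSpace ℝ (Fin 4),
        LinearMap.det (R.toLinearEquiv : EuclideanSpace ℝ (Fin 4) →ₗ[ℝ] EuclideanSpace ℝ (Fin 4)) = 1 →
          Tendsto (fun k : ℕ => curvDistribution r sch k p (linActMulti R F) - curvDistribution r sch k p F)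
            atTop (𝓝 0))
    {Δ : ℝ} (hCS : SpeciesScheme.HasCSClustering r (canon r sch) Δ)
    {K : ℕ → ℝ} {s : ℕ} (hK : ∀ p, 0 ≤ K p)
    (hb : ∀ᶠ k in atTop, ∀ (p : ℕ) (F : 𝓢((Fin p → EuclideanSpace ℝ (Fin 4)), ℂ)), IsOffDiagonal F →
      ‖curvDistribution r sch k p F‖ ≤ K p * schwartzNorm (p * s) F)
    {n m : ℕ} (hn : n ≠ 0) (hm : m ≠ 0) {i : Fin 3}
    {P : 𝓢((Fin n → EuclideanSpace ℝ (Fin 4)), ℂ)} {Q : 𝓢((Fin m → EuclideanSpace ℝ (Fin 4)), ℂ)}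
    (hP : P ∈ Submodule.span ℂ {P : 𝓢((Fin n → EuclideanSpace ℝ (Fin 4)), ℂ) |
        ∃ (p : Fin n → 𝓢(EuclideanSpace ℝ (Fin 4), ℝ)) (ρ : ℝ),
          IsTensorOf P (fun l => ofRealTest (p l)) ∧ IsSlabOrdered p ∧
            ∀ l, tsupport (p l : EuclideanSpace ℝ (Fin 4) → ℝ) ⊆ {x | |x i.succ| ≤ ρ}})
    (hQ : Q ∈ Submodule.span ℂ {Q : 𝓢((Fin m → EuclideanSpace ℝ (Fin 4)), ℂ) |
        ∃ (q : Fin m → 𝓢(EuclideanSpace ℝ (Fin 4), ℝ)) (ρ : ℝ),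
          IsTensorOf Q (fun l => ofRealTest (q l)) ∧ IsSlabOrdered q ∧
            ∀ l, tsupport (q l : EuclideanSpace ℝ (Fin 4) → ℝ) ⊆ {x | |x i.succ| ≤ ρ}})
    {a : EuclideanSpace ℝ (Fin 4)} (ha0 : a 0 = 0) (hai : a i.succ ≠ 0) {η : ℝ} (hη : 0 < η) :
    ∃ (σ₀ M : ℝ), 0 < σ₀ ∧ 0 ≤ M ∧ ∀ t : ℝ, 0 ≤ t → ∀ᶠ k in atTop,
      ‖curvDistribution r sch k (n + m) ((osAdjoint P).appendTensor (translateMulti (t • a) Q)) -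
          curvDistribution r sch k n (osAdjoint P) * curvDistribution r sch k m Q‖ ≤
        Real.exp (-Δ * (σ₀ * t)) * M + η := by
  classical
  have hPt : IsTimeOrdered P := isTimeOrdered_of_mem_span (mem_span_slabOrderedProducts_of_mem_span_bdd hP)
  have hQt : IsTimeOrdered Q := isTimeOrdered_of_mem_span (mem_span_slabOrderedProducts_of_mem_span_bdd hQ)
  -- §a unpack the spans
  obtain ⟨N, c, g, rfl⟩ := Submodule.mem_span_set'.1 hP
  obtain ⟨N', c', g', rfl⟩ := Submodule.mem_span_set'.1 hQ
  choose p ρp hpT hp hpρ using fun l => (g l).2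
  choose q ρq hqT hq hqρ using fun e => (g' e).2
  choose lo hi hlo hle hord hsupp using hp
  choose lo' hi' hlo' hle' hord' hsupp' using hq
  -- §b common bounds for the times and the `x^{i+1}`-coordinates on all supports
  set T : ℝ := (1 + ∑ x : Fin N × Fin n, |hi x.1 x.2|) + (1 + ∑ x : Fin N' × Fin m, |hi' x.1 x.2|) with hTdef
  set ρ : ℝ := (1 + ∑ l, |ρp l|) + (1 + ∑ e, |ρq e|) with hρdef
  have hsum1 : 0 ≤ ∑ x : Fin N × Fin n, |hi x.1 x.2| := Finset.sum_nonneg fun _ _ => abs_nonneg _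
  have hsum2 : 0 ≤ ∑ x : Fin N' × Fin m, |hi' x.1 x.2| := Finset.sum_nonneg fun _ _ => abs_nonneg _
  have hsum3 : 0 ≤ ∑ l, |ρp l| := Finset.sum_nonneg fun _ _ => abs_nonneg _
  have hsum4 : 0 ≤ ∑ e, |ρq e| := Finset.sum_nonneg fun _ _ => abs_nonneg _
  have hT_p : ∀ l u, hi l u ≤ T := fun l u => by
    have := le_one_add_sum_abs (fun x : Fin N × Fin n => hi x.1 x.2) (l, u)
    beta_reduce at this; linarith
  have hT_q : ∀ e u, hi' e u ≤ T := fun e u => by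
    have := le_one_add_sum_abs (fun x : Fin N' × Fin m => hi' x.1 x.2) (e, u)
    beta_reduce at this; linarith
  have hρ_p : ∀ l, ρp l ≤ ρ := fun l => by have := le_one_add_sum_abs ρp l; linarith
  have hρ_q : ∀ e, ρq e ≤ ρ := fun e => by have := le_one_add_sum_abs ρq e; linarith
  have hT0 : 0 < T := by linarith
  have hρ0 : 0 < ρ := by linarith
  have hpρ' : ∀ l u, tsupport (p l u : EuclideanSpace ℝ (Fin 4) → ℝ) ⊆ {x | |x i.succ| ≤ ρ} :=
    fun l u x hx => show |x i.succ| ≤ ρ from le_trans (hpρ l u hx) (hρ_p l)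
  have hqρ' : ∀ e u, tsupport (q e u : EuclideanSpace ℝ (Fin 4) → ℝ) ⊆ {x | |x i.succ| ≤ ρ} :=
    fun e u x hx => show |x i.succ| ≤ ρ from le_trans (hqρ e u hx) (hρ_q e)
  -- §c the common margin `δ`
  obtain ⟨δ₁, hδ₁, h1⟩ := exists_pos_le_forall (fun x : Fin N × Fin n => lo x.1 x.2) fun x => hlo x.1 x.2
  obtain ⟨δ₂, hδ₂, h2⟩ := exists_pos_le_forall
    (fun x : Fin N × {uu : Fin n × Fin n // uu.1 < uu.2} => lo x.1 x.2.1.2 - hi x.1 x.2.1.1)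
    fun x => sub_pos.2 (hord x.1 _ _ x.2.2)
  obtain ⟨δ₃, hδ₃, h3⟩ := exists_pos_le_forall (fun x : Fin N' × Fin m => lo' x.1 x.2) fun x => hlo' x.1 x.2
  obtain ⟨δ₄, hδ₄, h4⟩ := exists_pos_le_forall
    (fun x : Fin N' × {uu : Fin m × Fin m // uu.1 < uu.2} => lo' x.1 x.2.1.2 - hi' x.1 x.2.1.1)
    fun x => sub_pos.2 (hord' x.1 _ _ x.2.2)
  set δ : ℝ := min (min δ₁ δ₂) (min δ₃ δ₄) with hδdef
  have hδ : 0 < δ := lt_min (lt_min hδ₁ hδ₂) (lt_min hδ₃ hδ₄)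
  have hδle₁ : ∀ l u, δ ≤ lo l u := fun l u =>
    (min_le_left _ _).trans ((min_le_left _ _).trans (h1 (l, u)))
  have hδle₂ : ∀ l u u', u < u' → δ ≤ lo l u' - hi l u := fun l u u' huu =>
    (min_le_left _ _).trans ((min_le_right _ _).trans (h2 (l, ⟨(u, u'), huu⟩)))
  have hδle₃ : ∀ e u, δ ≤ lo' e u := fun e u =>
    (min_le_right _ _).trans ((min_le_left _ _).trans (h3 (e, u)))
  have hδle₄ : ∀ e u u', u < u' → δ ≤ lo' e u' - hi' e u := fun e u u' huu =>
    (min_le_right _ _).trans ((min_le_right _ _).trans (h4 (e, ⟨(u, u'), huu⟩)))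
  -- §d the rotation
  obtain ⟨R, cR, sR, hdet, hR0, -, hσs, hc0, hc1, h1c, hsabs⟩ :=
    hB i (a i.succ) (T + ρ) (δ / 8) hai (by positivity) (by positivity)
  set R' : EuclideanSpace ℝ (Fin 4) ≃ₗᵢ[ℝ] EuclideanSpace ℝ (Fin 4) :=
    (timeReflection 4).trans (R.trans (timeReflection 4)) with hR'def
  have hR'0 : ∀ x : EuclideanSpace ℝ (Fin 4), R' x 0 = cR * x 0 + (-sR) * x i.succ := fun x => by
    rw [hR'def, conjRot_apply_zero R hR0]; ring
  set marg : ℝ := δ / 4 with hmargdef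
  have hmarg0 : 0 ≤ marg := by positivity
  have hmarg : (1 - cR) * T + |sR| * ρ ≤ marg := by
    have e1 : (1 - cR) * T ≤ (1 - cR) * (T + ρ) := mul_le_mul_of_nonneg_left (by linarith) (by linarith)
    have e2 : |sR| * ρ ≤ |sR| * (T + ρ) := mul_le_mul_of_nonneg_left (by linarith) (abs_nonneg _)
    linarith
  have hmarg' : (1 - cR) * T + |-sR| * ρ ≤ marg := by rwa [abs_neg]
  have hm1p : ∀ l u, marg < lo l u := fun l u => by have := hδle₁ l u; linarith
  have hm2p : ∀ l u u', u < u' → hi l u + marg < lo l u' - marg := fun l u u' h => by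
    have := hδle₂ l u u' h; linarith
  have hm1q : ∀ e u, marg < lo' e u := fun e u => by have := hδle₃ e u; linarith
  have hm2q : ∀ e u u', u < u' → hi' e u + marg < lo' e u' - marg := fun e u u' h => by
    have := hδle₄ e u u' h; linarith
  -- §e the time separation
  set σ₀ : ℝ := sR * a i.succ with hσ₀def
  have hσ₀ : 0 < σ₀ := by rw [hσ₀def, mul_comm]; exact hσs
  have hS : ∀ t : ℝ, R (t • a) 0 = σ₀ * t := fun t => by
    rw [hR0, PiLp.smul_apply, PiLp.smul_apply, ha0, smul_eq_mul, smul_eq_mul, hσ₀def]; ring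
  -- §f the tilted lower object and its slab data
  set P₀ : 𝓢((Fin n → EuclideanSpace ℝ (Fin 4)), ℂ) := ∑ l, c l • (g l : 𝓢((Fin n → EuclideanSpace ℝ (Fin 4)), ℂ))
    with hP₀
  set Q₀ : 𝓢((Fin m → EuclideanSpace ℝ (Fin 4)), ℂ) := ∑ e, c' e • (g' e : 𝓢((Fin m → EuclideanSpace ℝ (Fin 4)), ℂ))
    with hQ₀
  set PR : 𝓢((Fin n → EuclideanSpace ℝ (Fin 4)), ℂ) := linActMulti R' P₀ with hPRdef
  set QR : 𝓢((Fin m → EuclideanSpace ℝ (Fin 4)), ℂ) := linActMulti R Q₀ with hQRdef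
  have hpPT : ∀ l, IsTensorOf (linActMulti R' (g l : 𝓢((Fin n → EuclideanSpace ℝ (Fin 4)), ℂ)))
      fun u => ofRealTest (linActTest R' (p l u)) := fun l => (hpT l).linActMulti R'
  have hpP : ∀ l, IsSlabOrdered fun u => linActTest R' (p l u) := fun l =>
    isSlabOrdered_tilt₀ (hlo l) (hle l) (hsupp l) (hpρ' l) (hT_p l) R' hR'0 hc0 hc1 hmarg0 hmarg'
      (hm1p l) (hm2p l)
  have hqQ₀ : ∀ e, IsSlabOrdered fun u => linActTest R (q e u) := fun e =>
    isSlabOrdered_tilt₀ (hlo' e) (hle' e) (hsupp' e) (hqρ' e) (hT_q e) R hR0 hc0 hc1 hmarg0 hmarg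
      (hm1q e) (hm2q e)
  have hPR_sum : PR = ∑ l, c l • linActMulti R' (g l : 𝓢((Fin n → EuclideanSpace ℝ (Fin 4)), ℂ)) := by
    rw [hPRdef, hP₀, map_sum]; exact Finset.sum_congr rfl fun l _ => map_smul _ _ _
  have hQR_sum : QR = ∑ e, c' e • linActMulti R (g' e : 𝓢((Fin m → EuclideanSpace ℝ (Fin 4)), ℂ)) := by
    rw [hQRdef, hQ₀, map_sum]; exact Finset.sum_congr rfl fun e _ => map_smul _ _ _
  have hPRt : IsTimeOrdered PR := by
    rw [hPR_sum]
    refine isTimeOrdered_of_mem_span (Submodule.sum_mem _ fun l _ => Submodule.smul_mem _ _ (Submodule.subset_span ?_))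
    exact (hpP l).mem_slabOrderedProducts (hpPT l)
  have hQRt0 : IsTimeOrdered QR := by
    rw [hQR_sum]
    refine isTimeOrdered_of_mem_span (Submodule.sum_mem _ fun e _ => Submodule.smul_mem _ _ (Submodule.subset_span ?_))
    exact (hqQ₀ e).mem_slabOrderedProducts ((hqT e).linActMulti R)
  have hQQ : IsOffDiagonal ((osAdjoint QR).appendTensor QR) :=
    OSReconstructionNoE1.isOffDiagonal_appendTensor_osAdjoint hQRt0 hQRt0
  have hPP : IsOffDiagonal ((osAdjoint PR).appendTensor PR) :=
    OSReconstructionNoE1.isOffDiagonal_appendTensor_osAdjoint hPRt hPRt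
  have hRP : linActMulti R (osAdjoint P₀) = osAdjoint PR := by rw [linActMulti_osAdjoint_conj]
  -- §g the constants
  set X : ℝ := K (n + n) * schwartzNorm ((n + n) * s) ((osAdjoint PR).appendTensor PR) with hXdef
  set Y : ℝ := K (m + m) * schwartzNorm ((m + m) * s) ((osAdjoint QR).appendTensor QR) + 1 with hYdef
  have hX0 : 0 ≤ X := mul_nonneg (hK _) (schwartzNorm_nonneg _ _)
  have hY0 : 0 ≤ Y := by
    have := mul_nonneg (hK (m + m)) (schwartzNorm_nonneg ((m + m) * s) ((osAdjoint QR).appendTensor QR)); linarith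
  set M : ℝ := Real.sqrt X * Real.sqrt Y with hMdef
  have hKQ : 0 ≤ K m * schwartzNorm (m * s) Q₀ := mul_nonneg (hK _) (schwartzNorm_nonneg _ _)
  have hKP : 0 ≤ K n * schwartzNorm (n * s) (osAdjoint P₀) := mul_nonneg (hK _) (schwartzNorm_nonneg _ _)
  set ηQ : ℝ := η / (4 * (K m * schwartzNorm (m * s) Q₀ + 2)) with hηQ
  set ηP : ℝ := min 1 (η / (4 * (K n * schwartzNorm (n * s) (osAdjoint P₀) + 1))) with hηP
  have hηQ0 : 0 < ηQ := by positivity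
  have hηP0 : 0 < ηP := lt_min one_pos (by positivity)
  have hηP1 : ηP ≤ 1 := min_le_left _ _
  refine ⟨σ₀, M, hσ₀, mul_nonneg (Real.sqrt_nonneg _) (Real.sqrt_nonneg _), fun t ht => ?_⟩
  -- §h the fixed `t`: the spatial remainder of the tilted translation, the tilted upper object
  set v : EuclideanSpace ℝ (Fin 4) := t • a with hv
  have hv0 : v 0 = 0 := by rw [hv, PiLp.smul_apply, ha0, smul_zero]
  set wt : EuclideanSpace ℝ (Fin 4) := R v - EuclideanSpace.single 0 (σ₀ * t) with hwt
  have hwt0 : wt 0 = 0 := by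
    rw [hwt, PiLp.sub_apply, hv, hS]; simp
  have hsplit : R v = EuclideanSpace.single 0 (σ₀ * t) + wt := by rw [hwt]; abel
  set QRT : 𝓢((Fin m → EuclideanSpace ℝ (Fin 4)), ℂ) := translateMulti wt QR with hQRT
  have hqQT : ∀ e, IsTensorOf (translateMulti wt (linActMulti R (g' e : 𝓢((Fin m → EuclideanSpace ℝ (Fin 4)), ℂ))))
      fun u => ofRealTest (translateTest wt (linActTest R (q e u))) := fun e => ((hqT e).linActMulti R).translateMulti wt
  have hqQ : ∀ e, IsSlabOrdered fun u => translateTest wt (linActTest R (q e u)) := fun e =>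
    isSlabOrdered_tilt (hlo' e) (hle' e) (hsupp' e) (hqρ' e) (hT_q e) R hR0 hc0 hc1 hmarg0 hmarg
      (hm1q e) (hm2q e) hwt0
  have hQRT_sum : QRT = ∑ e, c' e • translateMulti wt
      (linActMulti R (g' e : 𝓢((Fin m → EuclideanSpace ℝ (Fin 4)), ℂ))) := by
    rw [hQRT, hQR_sum, map_sum]
    exact Finset.sum_congr rfl fun e _ => map_smul _ _ _
  -- the joint tensor and its tilt
  set H : 𝓢((Fin (n + m) → EuclideanSpace ℝ (Fin 4)), ℂ) := (osAdjoint P₀).appendTensor (translateMulti v Q₀) with hHdef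
  have hHoff : IsOffDiagonal H :=
    OSReconstructionNoE1.isOffDiagonal_appendTensor_osAdjoint hPt (isTimeOrdered_translateMulti_spatial hv0 hQt)
  have hRH : linActMulti R H = (osAdjoint PR).appendTensor (translateMulti (EuclideanSpace.single 0 (σ₀ * t)) QRT) := by
    rw [hHdef, linActMulti_appendTensor, linActMulti_osAdjoint_conj, linActMulti_translateMulti, hsplit,
      ← translateMulti_translateMulti, ← hPRdef, ← hQRdef, ← hQRT]
  -- (1) (CSCL) on the tilted spans
  have hσt : 0 ≤ σ₀ * t := mul_nonneg hσ₀.le ht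
  have evCS := clustersCS_sum r sch hCS hn hm c c' hpPT hpP hqQT hqQ hσt (ε := η / 4) (by positivity)
  rw [← hPR_sum, ← hQRT_sum] at evCS
  -- (2) rotation invariance on `H` and on `ΘP*`; translation + rotation on `Q`; the `Q`-side norm
  have evT1 := eventually_norm_le_of_tendsto_zero (hROT _ H hHoff R hdet) (ε := η / 4) (by positivity)
  have evT2 := eventually_norm_le_of_tendsto_zero (hROT _ _ hPt.isOffDiagonal.osAdjoint R hdet) hηQ0
  have evT3a := eventually_norm_le_of_tendsto_zero (hTr m QR hQRt0.isOffDiagonal wt) (ε := ηP / 2) (by positivity)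
  have evT3b := eventually_norm_le_of_tendsto_zero (hROT _ Q₀ hQt.isOffDiagonal R hdet) (ε := ηP / 2) (by positivity)
  have evY := eventually_norm_le_of_tendsto_zero (hTr (m + m) _ hQQ wt) one_pos
  rw [hRP] at evT2
  rw [← hQRT] at evT3a
  rw [← hQRdef] at evT3b
  filter_upwards [evCS, evT1, evT2, evT3a, evT3b, evY, hb] with k hkCS hk1 hk2 hk3a hk3b hkY hkb
  -- the distributions at step `k`
  set D := curvDistribution r sch k with hD
  have hXk : Real.sqrt ‖D (n + n) ((osAdjoint PR).appendTensor PR)‖ ≤ Real.sqrt X :=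
    Real.sqrt_le_sqrt (hkb _ _ hPP)
  have hYk : Real.sqrt ‖D (m + m) ((osAdjoint QRT).appendTensor QRT)‖ ≤ Real.sqrt Y := by
    refine Real.sqrt_le_sqrt ?_
    have e1 : (osAdjoint QRT).appendTensor QRT = translateMulti wt ((osAdjoint QR).appendTensor QR) := by
      rw [hQRT]; exact osAdjoint_appendTensor_translateMulti_spatial hwt0 QR
    rw [e1]
    calc ‖D (m + m) (translateMulti wt ((osAdjoint QR).appendTensor QR))‖
        ≤ ‖D (m + m) ((osAdjoint QR).appendTensor QR)‖ +
          ‖D (m + m) (translateMulti wt ((osAdjoint QR).appendTensor QR)) - D (m + m) ((osAdjoint QR).appendTensor QR)‖ :=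
          norm_le_insert' _ _
      _ ≤ K (m + m) * schwartzNorm ((m + m) * s) ((osAdjoint QR).appendTensor QR) + 1 := add_le_add (hkb _ _ hQQ) hkY
  have hprod : Real.sqrt ‖D (n + n) ((osAdjoint PR).appendTensor PR)‖ *
      Real.sqrt ‖D (m + m) ((osAdjoint QRT).appendTensor QRT)‖ ≤ M := by
    rw [hMdef]; exact mul_le_mul hXk hYk (Real.sqrt_nonneg _) (Real.sqrt_nonneg _)
  -- the main Cauchy–Schwarz term
  have hmain : ‖D (n + m) (linActMulti R H) - D n (osAdjoint PR) * D m QRT‖ ≤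
      Real.exp (-Δ * (σ₀ * t)) * M + η / 4 := by
    rw [hRH]
    calc _ ≤ Real.exp (-Δ * (σ₀ * t)) * Real.sqrt ‖D (n + n) ((osAdjoint PR).appendTensor PR)‖ *
            Real.sqrt ‖D (m + m) ((osAdjoint QRT).appendTensor QRT)‖ + η / 4 := hkCS
      _ = Real.exp (-Δ * (σ₀ * t)) * (Real.sqrt ‖D (n + n) ((osAdjoint PR).appendTensor PR)‖ *
            Real.sqrt ‖D (m + m) ((osAdjoint QRT).appendTensor QRT)‖) + η / 4 := by ring
      _ ≤ Real.exp (-Δ * (σ₀ * t)) * M + η / 4 := by gcongr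
  -- the final bookkeeping
  exact tilt_final_estimate hKP hηP1 hηQ0.le (etaQ_mul_le hη hKQ) (mul_etaP_le hη hKP) hk1 hmain hk2 hk3a hk3b
    (hkb _ _ hQt.isOffDiagonal) (hkb _ _ hPt.isOffDiagonal.osAdjoint)

end Main

/-! ## §2 The registered sub-goal of part B -/

/-- `stub_uclOfCsclPartB` — **part B of `stub_uclOfCscl` (registered sub-goal of stmt-QuantumFields-15828, line
`Sketch`, reshape 15)**: the tilted main term on the spans (closed form of `span_main`). [folklore] -/
theorem stub_uclOfCsclPartB :
    ∀ (G : Type) [Group G] [TopologicalSpace G] [IsTopologicalGroup G] [CompactSpace G] [MeasurableSpace G] [BorelSpace G] (r : LatticeRep G) (sch : SpeciesScheme (YMSpecies G)), (∀ (i : Fin 3) (σ ρ g : ℝ), σ ≠ 0 → 0 < ρ → 0 < g → ∃ (R : EuclideanSpace ℝ (Fin 4) ≃ₗᵢ[ℝ] EuclideanSpace ℝ (Fin 4)) (c s : ℝ), LinearMap.det (R.toLinearEquiv : EuclideanSpace ℝ (Fin 4) →ₗ[ℝ] EuclideanSpace ℝ (Fin 4)) = 1 ∧ (∀ x : EuclideanSpace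 ℝ (Fin 4), R x 0 = c * x 0 + s * x i.succ) ∧ (∀ x : EuclideanSpace ℝ (Fin 4), R.symm x 0 = c * x 0 - s * x i.succ) ∧ 0 < σ * s ∧ 0 < c ∧ c ≤ 1 ∧ (1 - c) * ρ ≤ g ∧ |s| * ρ ≤ g) → Summit.QuantumFields.YangMills.Cruxes.ContinuumLimitOnTrajectory.TwoOrbitSynchronisation.AsympTransl r sch → (∀ (p : ℕ) (F : SchwartzMap (Fin p → EuclideanSpace ℝ (Fin 4)) ℂ), IsOffDiagonal F → ∀ R : EuclideanSpace ℝ (Fin 4) ≃ₗᵢ[ℝ] EuclideanSpace ℝ (Fin 4), LinearMap.det (R.toLinearEquiv : EuclideanSpace ℝ (Fin 4) →ₗ[ℝ] EuclideanSpace ℝ (Fin 4)) = 1 → Tendsto (fun k : ℕ => Summit.QuantumFields.YangMills.Cruxes.ContinuumLimitOnTrajectory.TwoOrbitSynchronisation.curvDistribution r sch k p (linActMulti R F) - Summit.QuantumFields.YangMills.Cruxes.ContinuumLimitOnTrajectory.TwoOrbitSynchronisation.curvDistribution r sch k p F) atTop (𝓝 0)) → ∀ (Δ : ℝ), SpeciesScheme.HasCSClustering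 r (Summit.QuantumFields.YangMills.Cruxes.ContinuumLimitOnTrajectory.TwoOrbitSynchronisation.canon r sch) Δ → ∀ (K : ℕ → ℝ) (s : ℕ), (∀ p, 0 ≤ K p) → (∀ᶠ k in atTop, ∀ (p : ℕ) (F : SchwartzMap (Fin p → EuclideanSpace ℝ (Fin 4)) ℂ), IsOffDiagonal F → ‖Summit.QuantumFields.YangMills.Cruxes.ContinuumLimitOnTrajectory.TwoOrbitSynchronisation.curvDistribution r sch k p F‖ ≤ K p * schwartzNorm (p * s) F) → ∀ (n m : ℕ), n ≠ 0 → m ≠ 0 → ∀ (i : Fin 3) (P : SchwartzMap (Fin n → EuclideanSpace ℝ (Fin 4)) ℂ) (Q : SchwartzMap (Fin m → EuclideanSpace ℝ (Fin 4)) ℂ), P ∈ Submodule.span ℂ {P : SchwartzMap (Fin n → EuclideanSpace ℝ (Fin 4)) ℂ | ∃ (p : Fin n → SchwartzMap (EuclideanSpace ℝ (Fin 4)) ℝ) (ρ : ℝ), IsTensorOf P (fun l => ofRealTest (p l)) ∧ IsSlabOrdered p ∧ ∀ l, tsupport (p l : EuclideanSpace ℝ (Fin 4) → ℝ) ⊆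 {x | |x i.succ| ≤ ρ}} → Q ∈ Submodule.span ℂ {Q : SchwartzMap (Fin m → EuclideanSpace ℝ (Fin 4)) ℂ | ∃ (q : Fin m → SchwartzMap (EuclideanSpace ℝ (Fin 4)) ℝ) (ρ : ℝ), IsTensorOf Q (fun l => ofRealTest (q l)) ∧ IsSlabOrdered q ∧ ∀ l, tsupport (q l : EuclideanSpace ℝ (Fin 4) → ℝ) ⊆ {x | |x i.succ| ≤ ρ}} → ∀ (a : EuclideanSpace ℝ (Fin 4)), a 0 = 0 → a i.succ ≠ 0 → ∀ (η : ℝ), 0 < η → ∃ (σ₀ M : ℝ), 0 < σ₀ ∧ 0 ≤ M ∧ ∀ t : ℝ, 0 ≤ t → ∀ᶠ k in atTop, ‖Summit.QuantumFields.YangMills.Cruxes.ContinuumLimitOnTrajectory.TwoOrbitSynchronisation.curvDistribution r sch k (n + m) ((osAdjoint P).appendTensor (translateMulti (t • a) Q)) - Summit.QuantumFields.YangMills.Cruxes.ContinuumLimitOnTrajectory.TwoOrbitSynchronisation.curvDistribution r sch k n (osAdjoint P) * Summit.QuantumFields.YangMills.Cruxes.ContinuumLimitOnTrajectory.TwoOrbitSynchronisation.curvDistribution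 r sch k m Q‖ ≤ Real.exp (-Δ * (σ₀ * t)) * M + η :=
  fun _ _ _ _ _ _ _ r sch hB hTr hROT _ hCS _ _ hK hb _ _ hn hm _ _ _ hP hQ _ ha0 hai _ hη =>
    span_main r sch hB hTr hROT hCS hK hb hn hm hP hQ ha0 hai hη

end Summit.QuantumFields.YangMills.Theorems.ContinuumLegGivenGap

end
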